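import Summits.Ventures.PercRepro.RankLevelSetCoreSevenOfFormS345

/-!
# PercRepro — THE NULLITY SPLIT, CASE B: a set of rank `≤ 7` carrying the whole nullity makes every other element a
coloop, and the top count a powerset (p8, gen 21; a feeder for S4 — the top of the `q = 7` window, the rows `52` and below)

* **`isColoop_of_notMem_of_full`** — if `|E| = r(E) + d`, `X ⊆ E` and `|X| ≥ r(X) + d`, every `y ∈ E ∖ X` is a coloop:
  otherwise `y ∈ cl(E ∖ {y})`, `M ＼ {y}` has rank `r(E)` and nullity `d − 1`, and `X ⊆ E ∖ {y}` would have `|X| ≤ r(X) + d − 1`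
  (night-1's nullity cap `Matroid.encard_le_eRk_add_of_encard_eq` on `M ＼ {y}`);
* **`topCount_le_two_pow_of_full`** — then `#U(p, 7) ≤ 2^{|X|}`: a spanning `A` contains a base, hence every coloop, hence
  `E ∖ X`; so `A ↦ E ∖ A` injects `U(p, 7)` into `𝒫(X)`.
The split core (RankLevelSetCoreSevenOfFormSplit) uses it with `|X| ≤ 7 + d`. Axioms: standard.
-/

open scoped Matroid

namespace PercRepro

namespace ThmN

open Set

variable {α : Type}

/-- **In case B every element outside the full-nullity set is a coloop**: if `|E| = r(E) + d`, `X ⊆ E` and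
`|X| = r(X) + d`, then every `y ∈ E ∖ X` is a coloop — otherwise `y ∈ cl(E ∖ {y})`, `M ＼ {y}` has rank `r(E)` and nullity
`d − 1`, and `X ⊆ E ∖ {y}` would have `|X| ≤ r(X) + d − 1`. -/
theorem isColoop_of_notMem_of_full (M : Matroid α) [M.Finite] {d : ℕ} (hd1 : 1 ≤ d)
    (hd : M.E.encard = M.eRank + d) {X : Set α} (hX : X ⊆ M.E) (hfull : M.eRk X + d ≤ (X.ncard : ℕ∞))
    {y : α} (hyE : y ∈ M.E) (hyX : y ∉ X) : M.IsColoop y := by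
  rw [Matroid.isColoop_iff_sdiff_closure]
  intro hcl
  have hr : M.eRk (M.E \ {y}) = M.eRank := by rw [← M.eRk_closure_eq, hcl, M.eRk_ground]
  have hXy : X ⊆ M.E \ {y} := by
    intro z hz
    exact ⟨hX hz, fun h => hyX (Set.mem_singleton_iff.1 h ▸ hz)⟩
  -- the nullity of `M ＼ {y}` is `d − 1`
  have hd' : (M ＼ {y}).E.encard = (M ＼ {y}).eRank + ((d - 1 : ℕ) : ℕ∞) := by
    have h1 : (M ＼ {y}).E.encard + 1 = M.E.encard := by
      rw [Matroid.delete_ground]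
      exact Set.encard_sdiff_singleton_add_one hyE
    have h2 : (M ＼ {y}).eRank = M.eRank := by
      rw [show (M ＼ {y}).eRank = M.eRk (M.E \ {y}) from rfl, hr]
    rw [h2]
    have h3 : ((d - 1 : ℕ) : ℕ∞) + 1 = (d : ℕ∞) := by
      rw [← Nat.cast_succ]
      exact congrArg (fun n : ℕ => (n : ℕ∞)) (by omega)
    rw [hd] at h1
    have h4 : (M ＼ {y}).E.encard + 1 = M.eRank + ((d - 1 : ℕ) : ℕ∞) + 1 := by
      rw [h1, add_assoc, h3]
    exact WithTop.add_right_cancel ENat.one_ne_top h4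
  have hXy' : X ⊆ (M ＼ {y}).E := by rw [Matroid.delete_ground]; exact hXy
  have hcap := PercRepro.Matroid.encard_le_eRk_add_of_encard_eq (M := M ＼ {y}) (S := X) hXy' hd'
  rw [show (M ＼ {y}).eRk X = M.eRk X from Matroid.restrict_eRk_eq M hXy] at hcap
  have hXfin : X.Finite := M.ground_finite.subset hX
  rw [hXfin.cast_ncard_eq] at hfull
  have hne : M.eRk X ≠ ⊤ := ((M.eRk_le_encard _).trans_lt hXfin.encard_lt_top).ne
  obtain ⟨r, hr'⟩ := ENat.ne_top_iff_exists.1 hne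
  rw [← hr'] at hcap hfull
  have e1 : r + d ≤ X.ncard := by
    have := hfull.trans (le_of_eq hXfin.cast_ncard_eq.symm)
    exact_mod_cast this
  have e2 : X.ncard ≤ r + (d - 1) := by
    have := (le_of_eq hXfin.cast_ncard_eq).trans hcap
    exact_mod_cast this
  omega

/-- **In case B the top count is at most the powerset of the full-nullity set**: `#U(p, 7) ≤ 2^{|X|}` — every spanning
set contains every coloop, hence `E ∖ X`, so `A ↦ E ∖ A` injects `U(p, 7)` into `𝒫(X)`. -/
theorem topCount_le_two_pow_of_full (M : Matroid α) [M.Finite] {p d : ℕ} (hd1 : 1 ≤ d)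
    (hR : M.eRank = (p : ℕ∞)) (hd : M.E.encard = M.eRank + d) {X : Set α} (hX : X ⊆ M.E)
    (hfull : M.eRk X + d ≤ (X.ncard : ℕ∞)) : Matroid.topCount M p 7 ≤ 2 ^ X.ncard := by
  classical
  have hXfin : X.Finite := M.ground_finite.subset hX
  unfold Matroid.topCount
  have hmaps : ∀ A ∈ {A : Set α | A ⊆ M.E ∧ M.eRk A = (p : ℕ∞) ∧ M.eRk (M.E \ A) = ((7 : ℕ) : ℕ∞)},
      M.E \ A ∈ 𝒫 X := by
    intro A hA
    have hsp : M.Spanning A := by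
      rw [Matroid.spanning_iff_eRk_le']
      exact ⟨by rw [hR, hA.2.1], hA.1⟩
    obtain ⟨B, hB, hBA⟩ := hsp.exists_isBase_subset
    intro y hy
    by_contra hyX
    have hco : M.IsColoop y := isColoop_of_notMem_of_full M hd1 hd hX hfull hy.1 hyX
    exact hy.2 (hBA (hco.mem_of_isBase hB))
  have hinj : Set.InjOn (fun A => M.E \ A)
      {A : Set α | A ⊆ M.E ∧ M.eRk A = (p : ℕ∞) ∧ M.eRk (M.E \ A) = ((7 : ℕ) : ℕ∞)} := by
    intro A hA A' hA' h
    simp only at h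
    rw [← Set.sdiff_sdiff_cancel_left hA.1, h, Set.sdiff_sdiff_cancel_left hA'.1]
  have := Set.ncard_le_ncard_of_injOn (fun A => M.E \ A) hmaps hinj hXfin.powerset
  rwa [Set.ncard_powerset X hXfin] at this

end ThmN

end PercRepro
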